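import Summits.Ventures.GridStability.Lyapunov.StructurePreservingBlockRoa
import Summits.Ventures.GridStability.Lyapunov.StructurePreservingBlockLevel
import HarnessLib

/-!
# TOY kernel witness — not a grid, no row: the weighted-leg block certificate END-TO-END in the kernel on a 4-bus toy
# with two frustrated triangles SHARING a leg

Venture GRIDFUSION, G2-SCALE cell; card «idea-3 (cycle 4) / signed-coupling-triangle-absorption» (HOME/IDEAS-G2.md § l.675; crit-1
GRADE PASS · NEW-COMBINATION, STATUS 2026-08-28T20:54:27Z); §K `Toy3` of the planner's scratch proof `HOME/idea-3/c4/BlockRoaW.lean`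
(sha16 ce7574047d5005c1) filed by the cell's Lean-lane seat gridfusion-sos-5 (g11) as the ONE toy the lead's T-row desk allows
(lead §58 D73: «at most ONE Bench toy … filed LAST and labelled ‹TOY kernel witness — not a grid, no row›»); namespace
`…Bench.SignedBlockToy`.  0 kit, 0 facts, no CERT-SIZE row, no RUNS row.  Chosen over the scratch file's 3-bus Toy 1 because it is
the smallest object exercising the K1′-specific hypothesis shape (a SHARED leg: `free_nonneg` with two triangles owning the pair
`{0, 1}`, where no edge-disjoint cover of K1 exists — `shared`); Toy 1 is its one-triangle sub-case.

WHAT IT SAYS.  Four machine buses (`M = D = 1`, `P⁰ = 0`), flat start `δ₀ = 2·arctan 0`; couplings: shared leg `b₀₁ = 20`, legs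
`b₀₂ = b₀₃ = 10`, frustrated bases `b₁₂ = b₁₃ = −1`, `b₂₃ = 0`.  Cover: triangles `(0; 1, 2)` and `(0; 1, 3)` at the interface box
`ρ = 4·arctan(1/3)`, datum `(4, 4, 7, 7)`, each taking mass `10` from the shared leg, `10` from its own leg, `1` from its base (so
`bfree ≡ 0`).  Every field of `BlockCover` and the level `c = 5` are discharged IN THE KERNEL by `norm_num` / `simp` / `fin_cases`
through `RatRows.fields_of_checks` / `level_of_check`, and `blockVT_holds` yields the synchronisation sentence `roa`; the
certified set is non-empty (`equilibrium_mem`).  A witness of the certificate SHAPE and PIPELINE only — a toy object, not a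
power system, not a benchmark; nothing here certifies a real grid.
-/

noncomputable section

open Set Filter Topology Real Finset
open Summit.Ventures.GridStability.Models.StructurePreserving
open Summit.Ventures.GridStability.Lyapunov.StructurePreserving
open Summit.Ventures.GridStability.Lyapunov.StructurePreserving.SignedBlock

namespace Summit.Ventures.GridStability.Bench.SignedBlockToy


/-- Toy couplings: shared leg `b₀₁ = 20`, legs `b₀₂ = b₀₃ = 10`, frustrated bases `b₁₂ = b₁₃ = −1`, `b₂₃ = 0`. -/
def b : Fin 4 → Fin 4 → ℝ := ![![0, 20, 10, 10], ![20, 0, -1, -1], ![10, -1, 0, 0], ![10, -1, 0, 0]]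

/-- Toy data: four machines, unit inertia and damping, zero injections. -/
def params : Params 4 where
  M := fun _ => 1
  D := fun _ => 1
  P0 := fun _ => 0
  b := b
  gen := Finset.univ

/-- The toy couplings are symmetric. -/
theorem b_symm (i j : Fin 4) : b i j = b j i := by
  fin_cases i <;> fin_cases j <;> simp [b]

/-- The toy data are well formed (positive inertias and dampings, symmetric couplings). -/
theorem wellFormed : params.WellFormed where
  M_pos := fun _ _ => by simp [params]
  M_eq_zero := fun i hi => absurd (Finset.mem_univ i) hi
  D_pos := fun _ => by simp [params]
  b_symm := b_symm

/-- Half-angle data `t = 0`: the flat start. -/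
def t : Fin 4 → ℝ := fun _ => 0

/-- The flat operating point `δ₀ᵢ = 2·arctan 0 = 0`. -/
def δ₀ : Fin 4 → ℝ := fun i => 2 * Real.arctan (t i)

/-- `δ₀ = 0`. -/
theorem δ₀_eq (i : Fin 4) : δ₀ i = 0 := by simp [δ₀, t]

/-- The flat start is a synchronous equilibrium of the toy (zero injections). -/
theorem isSyncEquilibrium : params.IsSyncEquilibrium δ₀ := fun i => by
  simp [Params.pe, Params.Pbar, Params.syncFreq, params, δ₀_eq]

/-- The toy coupling graph is connected (explicit walks to bus `0`). -/
theorem preconnected : params.couplingGraph.Preconnected := by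
  have a10 : params.couplingGraph.Adj 1 0 := ⟨by decide, by simp [params, b], by simp [params, b]⟩
  have a20 : params.couplingGraph.Adj 2 0 := ⟨by decide, by simp [params, b], by simp [params, b]⟩
  have a30 : params.couplingGraph.Adj 3 0 := ⟨by decide, by simp [params, b], by simp [params, b]⟩
  have r : ∀ u : Fin 4, params.couplingGraph.Reachable u 0 := by
    intro u
    fin_cases u
    · exact SimpleGraph.Reachable.refl _
    · exact a10.reachable
    · exact a20.reachable
    · exact a30.reachable
  exact fun u v => (r u).trans (r v).symm

/-- The two triangles; each takes `10` of the shared leg's `20`. -/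
def triA : Triangle 4 := ⟨0, 1, 2, RatRows.rho, 4, 4, 7, 7, 10, 10, 1⟩
/-- The second triangle `(0; 1, 3)`: same datum `(4, 4, 7, 7)`, mass `10` from the shared leg, `10` from its own leg, `1` from its base. -/
def triB : Triangle 4 := ⟨0, 1, 3, RatRows.rho, 4, 4, 7, 7, 10, 10, 1⟩

/-- Both triangles own the shared leg `{1, 0}`: no edge-disjoint cover by these triangles exists. -/
theorem shared : triA.Owns 1 0 ∧ triB.Owns 1 0 := by
  simp [triA, triB, Triangle.Owns]

/-- The fields of a flat triangle with mass `(10, 10)` and datum `(4, 4, 7, 7)` (shared by `triA`, `triB`). -/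
theorem fields (K : Triangle 4) (hK : K.ρ = RatRows.rho) (h1 : K.w₁ = 10) (h2 : K.w₂ = 10)
    (hm1 : K.m₁ = 4) (hm2 : K.m₂ = 4) (hq1 : K.q₁ = 7) (hq2 : K.q₂ = 7) :
    (|δ₀ K.leg₁ - δ₀ K.apex| + K.ρ ≤ π / 2 ∧ |δ₀ K.leg₂ - δ₀ K.apex| + K.ρ ≤ π / 2) ∧
    ((K.m₁ * K.ρ ^ 2 ≤ K.w₁ * U (δ₀ K.leg₁ - δ₀ K.apex) K.ρ ∧
      K.m₁ * K.ρ ^ 2 ≤ K.w₁ * U (δ₀ K.leg₁ - δ₀ K.apex) (-K.ρ)) ∧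
     (K.m₂ * K.ρ ^ 2 ≤ K.w₂ * U (δ₀ K.leg₂ - δ₀ K.apex) K.ρ ∧
      K.m₂ * K.ρ ^ 2 ≤ K.w₂ * U (δ₀ K.leg₂ - δ₀ K.apex) (-K.ρ))) ∧
    ((K.q₁ * K.ρ ≤ K.w₁ *
        (Real.sin (δ₀ K.leg₁ - δ₀ K.apex + K.ρ) - Real.sin (δ₀ K.leg₁ - δ₀ K.apex)) ∧
      K.q₁ * K.ρ ≤ K.w₁ *
        (Real.sin (δ₀ K.leg₁ - δ₀ K.apex) - Real.sin (δ₀ K.leg₁ - δ₀ K.apex - K.ρ))) ∧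
     (K.q₂ * K.ρ ≤ K.w₂ *
        (Real.sin (δ₀ K.leg₂ - δ₀ K.apex + K.ρ) - Real.sin (δ₀ K.leg₂ - δ₀ K.apex)) ∧
      K.q₂ * K.ρ ≤ K.w₂ *
        (Real.sin (δ₀ K.leg₂ - δ₀ K.apex) - Real.sin (δ₀ K.leg₂ - δ₀ K.apex - K.ρ)))) := by
  have hq₁ : hq (t K.leg₁) (t K.apex) = 0 := by simp [hq, t]
  have hq₂ : hq (t K.leg₂) (t K.apex) = 0 := by simp [hq, t]
  exact RatRows.fields_of_checks K hK t (by simp [t]) (by simp [t]) (by rw [h1]; norm_num)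
    (by rw [h2]; norm_num) (by rw [hm1]; norm_num) (by rw [hm2]; norm_num) (by rw [hq1]; norm_num)
    (by rw [hq2]; norm_num) (by rw [hq₁]; norm_num) (by rw [hq₂]; norm_num)
    (by rw [hq₁, h1, hm1]; norm_num) (by rw [hq₂, h2, hm2]; norm_num)
    (by rw [hq₁, h1, hq1]; norm_num) (by rw [hq₂, h2, hq2]; norm_num)

/-- The two coefficient tables add up to at most `b` (here: exactly `b`). -/
theorem coef_sum_le (i j : Fin 4) : 0 ≤ params.b i j - (triA.coef i j + triB.coef i j) := by
  fin_cases i <;> fin_cases j <;> simp [params, b, triA, triB, Triangle.coef] <;> norm_num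

/-- **The toy-3 cover: two triangles sharing the leg `{0, 1}`.** -/
def cover : BlockCover params δ₀ where
  t := 2
  tri := ![triA, triB]
  distinct := fun k => by fin_cases k <;> simp [triA, triB]
  legs_pos := fun k => by fin_cases k <;> norm_num [triA, triB]
  base_nonneg := fun k => by fin_cases k <;> norm_num [triA, triB]
  free_nonneg := fun i j => by
    have h := coef_sum_le i j
    have hs : ∑ k, ((![triA, triB] : Fin 2 → Triangle 4) k).coef i j = triA.coef i j + triB.coef i j :=
      Fin.sum_univ_two _
    rw [hs]
    exact h
  ρ_pos := fun k => by fin_cases k <;> exact RatRows.rho_pos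
  window := fun k => by
    fin_cases k
    · exact (fields triA rfl rfl rfl rfl rfl rfl rfl).1
    · exact (fields triB rfl rfl rfl rfl rfl rfl rfl).1
  row_m := fun k => by
    fin_cases k
    · exact (fields triA rfl rfl rfl rfl rfl rfl rfl).2.1
    · exact (fields triB rfl rfl rfl rfl rfl rfl rfl).2.1
  row_q := fun k => by
    fin_cases k
    · exact (fields triA rfl rfl rfl rfl rfl rfl rfl).2.2
    · exact (fields triB rfl rfl rfl rfl rfl rfl rfl).2.2
  harmonic_m := fun k => by fin_cases k <;> norm_num [triA, triB]
  harmonic_q := fun k => by fin_cases k <;> norm_num [triA, triB]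

/-- No free coupling is left: the shared leg's `20` is split `10 + 10`. -/
theorem bfree_eq (i j : Fin 4) : cover.bfree i j = 0 := by
  have hs : cover.bfree i j = params.b i j - (triA.coef i j + triB.coef i j) := by
    unfold BlockCover.bfree
    congr 1
    exact Fin.sum_univ_two _
  rw [hs]
  fin_cases i <;> fin_cases j <;> simp [params, b, triA, triB, Triangle.coef] <;> norm_num

/-- The equilibrium window on pairs with free coupling (vacuous: no free coupling is left). -/
theorem h0 : ∀ i j, cover.bfree i j ≠ 0 → |δ₀ i - δ₀ j| < π / 2 := fun i j _ => by
  rw [δ₀_eq, δ₀_eq, sub_self, abs_zero]; positivity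

/-- **The level `c = 5` is below every face** (no free coupling is left; block faces via `level_of_check`). -/
theorem level : cover.LevelBelowFaces 5 := by
  refine ⟨fun i j hij => absurd (bfree_eq i j) hij, fun k => ?_⟩
  fin_cases k
  · show (5 : ℝ) < triA.face triA.γ
    exact RatRows.level_of_check triA rfl (by norm_num [triA]) (by norm_num [triA]) (by norm_num [triA])
      (by norm_num [triA])
  · show (5 : ℝ) < triB.face triB.γ
    exact RatRows.level_of_check triB rfl (by norm_num [triB]) (by norm_num [triB]) (by norm_num [triB])
      (by norm_num [triB])

/-- **End-to-end on toy 3: the synchronisation sentence at level 5 with a SHARED leg.** -/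
theorem roa {y : (Fin 4 → ℝ) × (Fin 4 → ℝ)}
    (hy : y ∈ cover.region ∩ constraintSet params δ₀ ∧ phaseEnergy params δ₀ y ≤ 5) :
    (∃ X : ℝ → (Fin 4 → ℝ) × (Fin 4 → ℝ), X 0 = y ∧
      ∀ T : ℝ, ∀ t ∈ Icc 0 T, HasDerivWithinAt X (phaseField params (X t)) (Icc 0 T) t) ∧
    ∀ X : ℝ → (Fin 4 → ℝ) × (Fin 4 → ℝ), X 0 = y →
      (∀ T : ℝ, ∀ t ∈ Icc 0 T, HasDerivWithinAt X (phaseField params (X t)) (Icc 0 T) t) →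
      (∀ t, 0 ≤ t → X t ∈ cover.region ∩ constraintSet params δ₀ ∧ phaseEnergy params δ₀ (X t) ≤ 5) ∧
        Tendsto X atTop (𝓝 (δ₀, 0)) :=
  blockVT_holds 4 params wellFormed (by norm_num) preconnected δ₀ isSyncEquilibrium cover h0 5 level y hy

/-- The toy certified set is not empty: it contains the equilibrium state. -/
theorem equilibrium_mem :
    ((δ₀, 0) : (Fin 4 → ℝ) × (Fin 4 → ℝ)) ∈ cover.region ∩ constraintSet params δ₀ ∧
      phaseEnergy params δ₀ ((δ₀, 0) : (Fin 4 → ℝ) × (Fin 4 → ℝ)) ≤ 5 :=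
  cover.equilibrium_mem_sublevel h0 (by norm_num)


end Summit.Ventures.GridStability.Bench.SignedBlockToy

end
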